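import Summits.ValiantsHypothesis.ValiantsHypothesis.Theorems.MonotoneRestorationOrbitRestorationQPBlockProducts
import HarnessLib

/-!
# Worked example: the product of the differences of all non-attacking entries (ORBIT currency, XVI)

Route MonotoneRestoration, crux `OrbitRestorationQP` (stmt-ValiantsHypothesis-18293), namespace
`Summit.ValiantsHypothesis.ValiantsHypothesis.Theorems.BlockProducts`.

A usage check of the block criterion `qpOrbitRestorable_of_blocks` on the matrix-symmetric ΠΣ test family of
the repair census (W3, "one form per line with nontrivial sign character"):
`f_n = Π_{i<j} Π_{k≠l} (x_ik − x_jl)`, the product over all unordered pairs of entries in distinct rows and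
distinct columns of their difference.  It is invariant under independent row and column permutations, but its
factor multiset is NOT stable under the diagonal action (the pair `{(i,k),(j,l)}` with `i,j,k,l` distinct is
reversed by `(i j)(k l)`, which negates the factor), so neither the orbit circuit of a stable term multiset
(stub B) nor `qpOrbitRestorable_of_affineProductTerms` applies to the naive factorisation.  Blocking by the
unordered ROW PAIR cures it: `g_{ij} := Π_{k≠l} (x_ik − x_jl)` satisfies `g_{ij} = g_{ji}` (an even number
`n(n-1)` of sign changes) and `σ · g_{ij} = g_{σi σj}`, its operand multiset is permuted exactly by the
pointwise stabiliser of `{i,j}`, and every factor is supported by `4` indices; hence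
(`nonAttacking_qpOrbitRestorable`) `f_n` is `QPOrbitRestorable 9` at every `n` — blocks indexed by
`Sym2 (Fin n)` (diagonal blocks empty).  Everything is proved. [folklore]
-/

noncomputable section

open scoped Classical

-- `Summit.ValiantsHypothesis.ValiantsHypothesis.…` is the tree's single-conjunct layout (Sub = Summit).
set_option linter.dupNamespace false

namespace Summit.ValiantsHypothesis.ValiantsHypothesis.Theorems

namespace BlockProducts

open Equiv Finset Literature.Computability.AlgebraicComplexity OrbitRestorationQPDepthThreeRung

variable {n : ℕ}

/-! ### The row-pair blocks -/

/-- The off-diagonal index pairs are permuted by `σ × σ`. [folklore] -/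
theorem map_offDiag_val (σ : Perm (Fin n)) :
    ((univ : Finset (Fin n)).offDiag.val.map fun kl : Fin n × Fin n => (σ kl.1, σ kl.2)) =
      (univ : Finset (Fin n)).offDiag.val := by
  let e : (Fin n × Fin n) ↪ (Fin n × Fin n) :=
    ⟨fun kl => (σ kl.1, σ kl.2), fun a b h => by
      simp only [Prod.mk.injEq, EmbeddingLike.apply_eq_iff_eq] at h
      exact Prod.ext h.1 h.2⟩
  have hsub : (univ : Finset (Fin n)).offDiag.map e ⊆ (univ : Finset (Fin n)).offDiag := by
    intro p hp
    obtain ⟨kl, hkl, rfl⟩ := Finset.mem_map.1 hp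
    simp only [Finset.mem_offDiag, Finset.mem_univ, true_and] at hkl ⊢
    exact fun h => hkl (σ.injective h)
  have heq : (univ : Finset (Fin n)).offDiag.map e = (univ : Finset (Fin n)).offDiag :=
    Finset.eq_of_subset_of_card_le hsub (by rw [Finset.card_map])
  have h := congrArg Finset.val heq
  rw [Finset.map_val] at h
  exact h

/-- Renaming the block `{x_ik − x_jl : k ≠ l}` by `σ` gives the block of `(σ i, σ j)`. [folklore] -/
theorem map_ren_block (σ : Perm (Fin n)) (i j : Fin n) :
    ((univ : Finset (Fin n)).offDiag.val.map fun kl : Fin n × Fin n =>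
        (MvPolynomial.X (i, kl.1) - MvPolynomial.X (j, kl.2) : MvPolynomial (Fin n × Fin n) ℂ)).map (ren σ) =
      (univ : Finset (Fin n)).offDiag.val.map fun kl : Fin n × Fin n =>
        (MvPolynomial.X (σ i, kl.1) - MvPolynomial.X (σ j, kl.2) : MvPolynomial (Fin n × Fin n) ℂ) := by
  conv_rhs => rw [← map_offDiag_val σ]
  rw [Multiset.map_map, Multiset.map_map]
  refine Multiset.map_congr rfl fun kl _ => ?_
  simp only [Function.comp_apply, map_sub, ren_X, Prod.smul_mk, Perm.smul_def]

/-- The block product `g_{ij} = Π_{k≠l} (x_ik − x_jl)` is symmetric in `(i, j)`: reversing every pair changes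
the sign `n(n-1)` times. [folklore] -/
theorem block_prod_comm (i j : Fin n) :
    ((univ : Finset (Fin n)).offDiag.val.map fun kl : Fin n × Fin n =>
        (MvPolynomial.X (i, kl.1) - MvPolynomial.X (j, kl.2) : MvPolynomial (Fin n × Fin n) ℂ)).prod =
      ((univ : Finset (Fin n)).offDiag.val.map fun kl : Fin n × Fin n =>
        (MvPolynomial.X (j, kl.1) - MvPolynomial.X (i, kl.2) : MvPolynomial (Fin n × Fin n) ℂ)).prod := by
  rw [← Finset.prod_eq_multiset_prod, ← Finset.prod_eq_multiset_prod]
  -- reverse the pairs on the right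
  have hswap : ∏ kl ∈ (univ : Finset (Fin n)).offDiag,
      (MvPolynomial.X (j, kl.1) - MvPolynomial.X (i, kl.2) : MvPolynomial (Fin n × Fin n) ℂ) =
      ∏ kl ∈ (univ : Finset (Fin n)).offDiag, (MvPolynomial.X (j, kl.2) - MvPolynomial.X (i, kl.1)) := by
    refine Finset.prod_equiv (Equiv.prodComm (Fin n) (Fin n)) (fun kl => ?_) (fun kl _ => rfl)
    simp only [Finset.mem_offDiag, Finset.mem_univ, true_and, Equiv.prodComm_apply, Prod.fst_swap,
      Prod.snd_swap, ne_comm]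
  rw [hswap]
  have hneg : ∀ kl : Fin n × Fin n, (MvPolynomial.X (j, kl.2) - MvPolynomial.X (i, kl.1) :
      MvPolynomial (Fin n × Fin n) ℂ) = -(MvPolynomial.X (i, kl.1) - MvPolynomial.X (j, kl.2)) := fun kl => by ring
  simp only [hneg]
  rw [Finset.prod_neg, Finset.offDiag_card, Finset.card_univ, Fintype.card_fin]
  have heven : Even (n * n - n) := by rw [← Nat.mul_sub_one]; exact Nat.even_mul_pred_self n
  rw [heven.neg_one_pow, one_mul]

/-- **`Π_{i<j} Π_{k≠l} (x_ik − x_jl)` is `QPOrbitRestorable 9`** at every `n` (blocks = unordered row pairs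
`b ∈ Sym2 (Fin n)`, the block of `b` being `{x_{(inf b) k} − x_{(sup b) l} : k ≠ l}`, empty on the diagonal).
[folklore] -/
theorem nonAttacking_qpOrbitRestorable (n : ℕ) :
    QPOrbitRestorable 9 n (∏ b : Sym2 (Fin n), if b.IsDiag then 1 else
      ((univ : Finset (Fin n)).offDiag.val.map fun kl : Fin n × Fin n =>
        (MvPolynomial.X (b.inf, kl.1) - MvPolynomial.X (b.sup, kl.2) : MvPolynomial (Fin n × Fin n) ℂ)).prod) := by
  -- the diagonal action on unordered pairs
  letI : MulAction (Perm (Fin n)) (Sym2 (Fin n)) :=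
    { smul := fun σ b => Sym2.map σ b
      one_smul := fun b => by
        change Sym2.map (⇑(1 : Perm (Fin n))) b = b
        rw [Perm.coe_one, Sym2.map_id, id]
      mul_smul := fun σ τ b => by
        change Sym2.map (⇑(σ * τ)) b = Sym2.map σ (Sym2.map τ b)
        rw [Perm.coe_mul, Sym2.map_map] }
  have hsmul : ∀ (σ : Perm (Fin n)) (i j : Fin n), σ • (s(i, j) : Sym2 (Fin n)) = s(σ i, σ j) :=
    fun σ i j => rfl
  -- the blocks
  let N : Fin n → Fin n → Multiset (MvPolynomial (Fin n × Fin n) ℂ) := fun i j =>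
    (univ : Finset (Fin n)).offDiag.val.map fun kl : Fin n × Fin n =>
      (MvPolynomial.X (i, kl.1) - MvPolynomial.X (j, kl.2) : MvPolynomial (Fin n × Fin n) ℂ)
  have hN : ∀ i j, N i j = (univ : Finset (Fin n)).offDiag.val.map fun kl : Fin n × Fin n =>
      (MvPolynomial.X (i, kl.1) - MvPolynomial.X (j, kl.2) : MvPolynomial (Fin n × Fin n) ℂ) := fun _ _ => rfl
  let M : Sym2 (Fin n) → Multiset (MvPolynomial (Fin n × Fin n) ℂ) := fun b =>
    if b.IsDiag then 0 else N b.inf b.sup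
  have hM : ∀ b, M b = if b.IsDiag then 0 else N b.inf b.sup := fun _ => rfl
  -- the block product of an off-diagonal pair, in either order
  have hprod_mk : ∀ i j : Fin n, i ≠ j → (M s(i, j)).prod = (N i j).prod := by
    intro i j hij
    rw [hM, if_neg (by rwa [Sym2.mk_isDiag_iff]), Sym2.inf_mk, Sym2.sup_mk]
    rcases le_total i j with h | h
    · rw [min_eq_left h, max_eq_right h]
    · rw [min_eq_right h, max_eq_left h, hN, hN, block_prod_comm]
  have hprod_diag : ∀ i : Fin n, (M s(i, i)).prod = 1 := fun i => by
    rw [hM, if_pos (Sym2.mk_isDiag_iff.2 rfl), Multiset.prod_zero]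
  -- the statement is the block product with `a = 1`
  have hf : (∏ b : Sym2 (Fin n), if b.IsDiag then 1 else
      ((univ : Finset (Fin n)).offDiag.val.map fun kl : Fin n × Fin n =>
        (MvPolynomial.X (b.inf, kl.1) - MvPolynomial.X (b.sup, kl.2) : MvPolynomial (Fin n × Fin n) ℂ)).prod) =
      MvPolynomial.C 1 * ∏ b : Sym2 (Fin n), (M b).prod := by
    rw [map_one, one_mul]
    refine Finset.prod_congr rfl fun b _ => ?_
    rw [hM]; split_ifs <;> simp [hN]
  rw [hf]
  refine qpOrbitRestorable_of_blocks (k := 4) M 1 (fun b q hq => ?_) (fun b q hq => ?_) (fun b => ?_)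
    (fun σ b => ?_)
  · -- affine
    rw [hM] at hq
    split_ifs at hq with hb
    · simp at hq
    · obtain ⟨kl, -, rfl⟩ := Multiset.mem_map.1 hq
      refine (MvPolynomial.totalDegree_sub _ _).trans (max_le ?_ ?_) <;> exact (MvPolynomial.totalDegree_X _).le
  · -- supported by `{inf b, sup b, k, l}`
    rw [hM] at hq
    split_ifs at hq with hb
    · simp at hq
    · obtain ⟨kl, -, rfl⟩ := Multiset.mem_map.1 hq
      refine ⟨{b.inf, b.sup, kl.1, kl.2}, (Finset.card_le_four).trans le_rfl, fun σ hσ => ?_⟩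
      simp only [Finset.mem_insert, Finset.mem_singleton, forall_eq_or_imp, forall_eq] at hσ
      simp only [map_sub, ren_X, Prod.smul_mk, Perm.smul_def, hσ.1, hσ.2.1, hσ.2.2.1, hσ.2.2.2]
  · -- exactly permuted by the pointwise stabiliser of `{inf b, sup b}`
    refine ⟨{b.inf, b.sup}, (Finset.card_le_two).trans (by norm_num), fun σ hσ => ?_⟩
    simp only [Finset.mem_insert, Finset.mem_singleton, forall_eq_or_imp, forall_eq] at hσ
    rw [hM]
    split_ifs with hb
    · rfl
    · rw [hN, map_ren_block, hσ.1, hσ.2]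
  · -- equivariance of the block products
    induction b using Sym2.ind with
    | h i j =>
      rw [hsmul]
      by_cases hij : i = j
      · subst hij; rw [hprod_diag, hprod_diag, map_one]
      · rw [hprod_mk i j hij, hprod_mk (σ i) (σ j) (fun h => hij (σ.injective h)), hN, map_multiset_prod,
          map_ren_block]

end BlockProducts

end Summit.ValiantsHypothesis.ValiantsHypothesis.Theorems

end
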